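import Summits.QuantumFields.BalabanUV.T4Continuum.Support.NE7K1LinTwoRunLower
import Summits.QuantumFields.BalabanUV.T4Continuum.Support.NE7K1LinSchurLineDerivRel

/-!
# NE7K1LinSchurLineDerivU1 — row NE7 (node U5), candidate route HOM, path H1L, cell K1-lin(s): the η-UNIFORM `∂_s` LETTER AT
# U = 1 — the interpolated two-cutoff propagator `G(s) = (twoCutoffLine s)⁻¹` is LIPSCHITZ IN `s` in operator norm with a
# constant depending on `d, L, a` only: `‖(G(s) − G(t))g‖ ≤ |t−s|·(L²∕(c₁²·min(2,a)))·‖g‖`, `c₁ = (3((d+1)L²+1)L^{d−1})⁻¹`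

Lineage `b2b-balaban-t4-ne7-p2` (CRUX PROVER NE7 #2), generation 64; assembly of this generation's pieces:
`NE7K1LinSchurLineDerivRel.lineOpR_inv_sub_inv_rel` (the `∂_s` letter in FORM-RELATIVE currency, abstract) fed with the
TWO-RUN COMPARISON at `A = 0` — `NE7K1LinTwoRunUpper.schurB_form_le` (`P_B^{Schur} ≤ L²·P_A`) and
`NE7K1LinTwoRunLower.runA_form_le_schurB` (`c₁·P_A ≤ P_B^{Schur}`) — and B4 (1.8) at `A = 0` (`B4Lower18.lower18_zero`,
floor `min(2,a)` for run A, hence `c₁·min(2,a)` for both endpoints).  WHY: PRICING-NE7 v16.1 §98 P-v16.1-3 ∕ lens 1 (π1) asked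
for the `∂_s` kernel of the line; `NE7K1LinSchurLineDeriv` (p288057) gave it in the weighted-`ℓ²`∕Schur-test currency, whose
constants are MESH-DEPENDENT at U = 1 (`NE7K1LinSchurLineDerivRel.schurTest_runA_ge`: `K_{P₀} ≥ n²`).  THIS FILE gives the
mesh-FREE statement (unweighted `ℓ²`; the price is the two-run comparability, a K1-var-type input, here PROVED at `A = 0`):

* `schurB_isSymm` — `P_B^{Schur} = A₁ − BD⁻¹C` is symmetric (blocks of the symmetric `runB`);
* **`twoCutoff_inv_lipschitz`**: for `a > 0`, `n ≥ 1`, `L ≥ 1`, `R′` a union of `nL`-blocks, `s, t ∈ [0,1]` and every `g`,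
  `‖((twoCutoffLine s)⁻¹ − (twoCutoffLine t)⁻¹)g‖² ≤ (t−s)²·(L²∕(c₁·(c₁·min(2,a))))²·‖g‖²` — NO power of the mesh `n`
  (contrast: the Schur-test route degrades like `n⁴`).  Letters: `σ = c₁·min(2,a)` (common floor), `K = L²`
  (`|⟨v,(P_B^{Schur} − P_A)v⟩| ≤ L²⟨v,P_Av⟩` from the two halves), `c₁` as displayed.

HONEST FRAMING: Gaussian `A = 0` only (no background field, no gauge group, no minimisers, no R-operation); unweighted (the
weighted∕decaying version of the η-uniform letter needs the form-relative conjugation-error bounds — not here); crude constants;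
[folklore] over the tree's B4 certificates; nothing printed asserted; no `sorry`.  FIXED FINITE T⁴, rung (B)+1; NE7 NOT
PRINTED ∕ NOT PROVED; spine 0∕9; NOT infinite volume, NOT mass gap, NOT Clay.  HONEST DEPENDENCY: continuum YM on T⁴ ⇐ BetaPertH
∧ nine spine estimates (0/9 proved); BetaPertH ⇐ (D1) ∧ (D4) ∧ CAP+tail; G-an2-4 gates asym, D1 and NE2/3/4.
-/

noncomputable section

open Finset Matrix

namespace Summit.QuantumFields.BalabanUV.T4Continuum.NE7K1LinSchurLineDerivU1

open Literature.MathematicalPhysics.QuantumFieldTheory.Balaban1983to89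
open Literature.MathematicalPhysics.QuantumFieldTheory.Balaban1983to89.B4Reflection242
open Literature.MathematicalPhysics.QuantumFieldTheory.Balaban1983to89.B4Lower18
open NE7K1LinSchurLineForm NE7K1LinBlockCoords NE7K1LinSchurLineU1 NE7K1LinTwoRunKit NE7K1LinTwoRunUpper
  NE7K1LinTwoRunLower NE7K1LinSchurLineDerivRel

variable {d n L : ℕ} [NeZero L] {R' : Finset (Fin (d + 1) → ℤ)}

/-- `P_B^{Schur} = A₁ − BD⁻¹C` (blocks of the symmetric `runB`) is symmetric. [folklore] -/
theorem schurB_isSymm (hR'L : IsBlockUnion L R') (n : ℕ) (a : ℝ) :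
    ((runB hR'L n a).toBlocks₁₁ - (runB hR'L n a).toBlocks₁₂ * ((runB hR'L n a).toBlocks₂₂)⁻¹ *
      (runB hR'L n a).toBlocks₂₁).IsSymm := by
  set H := runB hR'L n a with hH
  have hblocks := (Matrix.isSymm_fromBlocks_iff.1 (by rw [fromBlocks_toBlocks H]; exact runB_isSymm hR'L n a))
  obtain ⟨hA, hBC, hCB, hD⟩ := hblocks
  unfold Matrix.IsSymm at hA hD ⊢
  rw [transpose_sub, transpose_mul, transpose_mul, transpose_nonsing_inv, hA, hD, hBC, hCB, Matrix.mul_assoc]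

/-- **THE η-UNIFORM `∂_s` LETTER AT U = 1.**  For `a > 0`, `n ≥ 1`, `R′` a union of `nL`-blocks, `s, t ∈ [0,1]`, every `g`:
`‖((twoCutoffLine s)⁻¹ − (twoCutoffLine t)⁻¹)g‖² ≤ (t−s)²·(L²∕(c₁·(c₁·min(2,a))))²·‖g‖²`,
`c₁ = ((6(d+1)L² + 6)L^{d+1}∕(2L²))⁻¹` — mesh-free. [folklore] -/
theorem twoCutoff_inv_lipschitz (hn : 1 ≤ n) (hR' : IsBlockUnion (n * L) R') {a : ℝ} (ha : 0 < a)
    {s t : ℝ} (hs0 : 0 ≤ s) (hs1 : s ≤ 1) (ht0 : 0 ≤ t) (ht1 : t ≤ 1) (g : ↥(R'.image (blk L)) → ℝ) :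
    ((twoCutoffLine (isBlockUnion_fine hR') n a s)⁻¹ - (twoCutoffLine (isBlockUnion_fine hR') n a t)⁻¹).mulVec g ⬝ᵥ
        ((twoCutoffLine (isBlockUnion_fine hR') n a s)⁻¹ - (twoCutoffLine (isBlockUnion_fine hR') n a t)⁻¹).mulVec g ≤
      (t - s) ^ 2 * ((L : ℝ) ^ 2 / (((6 * ((d : ℝ) + 1) * (L : ℝ) ^ 2 + 6) * (L : ℝ) ^ (d + 1) / (2 * (L : ℝ) ^ 2))⁻¹ *
        ((((6 * ((d : ℝ) + 1) * (L : ℝ) ^ 2 + 6) * (L : ℝ) ^ (d + 1) / (2 * (L : ℝ) ^ 2))⁻¹) * min 2 a))) ^ 2 * (g ⬝ᵥ g) := by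
  have hL : 1 ≤ L := NeZero.one_le
  have hR'L : IsBlockUnion L R' := isBlockUnion_fine hR'
  have hRc : IsBlockUnion n (R'.image (blk L)) := isBlockUnion_coarse hL hR'
  have hmin : 0 < min 2 a := lt_min (by norm_num) ha
  set c₁ : ℝ := ((6 * ((d : ℝ) + 1) * (L : ℝ) ^ 2 + 6) * (L : ℝ) ^ (d + 1) / (2 * (L : ℝ) ^ 2))⁻¹ with hc₁
  have hc₁pos : 0 < c₁ := lowerConst_pos d L
  have hc₁le : c₁ ≤ 1 := lowerConst_le_one d L
  have hL2 : (1 : ℝ) ≤ (L : ℝ) ^ 2 := one_le_pow₀ (by exact_mod_cast hL)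
  set H := runB hR'L n a with hH
  -- the two endpoints and their comparison
  have hP₀ : ∀ v, c₁ * min 2 a * (v ⬝ᵥ v) ≤ v ⬝ᵥ (runA n L a R').mulVec v := by
    intro v
    have h := lower18_zero hn ha.le hRc v
    have hvv : 0 ≤ v ⬝ᵥ v := by
      simp only [dotProduct]; exact Finset.sum_nonneg fun _ _ => mul_self_nonneg _
    have : c₁ * min 2 a * (v ⬝ᵥ v) ≤ 1 * min 2 a * (v ⬝ᵥ v) := by gcongr
    exact le_trans (by linarith) h
  have hP₀nn : ∀ v, 0 ≤ v ⬝ᵥ (runA n L a R').mulVec v := fun v =>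
    le_trans (mul_nonneg (mul_nonneg hc₁pos.le hmin.le) (by
      simp only [dotProduct]; exact Finset.sum_nonneg fun _ _ => mul_self_nonneg _)) (hP₀ v)
  have hlow' : ∀ v, c₁ * (v ⬝ᵥ (runA n L a R').mulVec v) ≤ v ⬝ᵥ (twoCutoffLine hR'L n a 1).mulVec v :=
    fun v => runA_form_le_schurB hn hR' ha v
  have hup' : ∀ v, v ⬝ᵥ (twoCutoffLine hR'L n a 1).mulVec v ≤ (L : ℝ) ^ 2 * (v ⬝ᵥ (runA n L a R').mulVec v) :=
    fun v => schurB_form_le hn hR' ha v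
  simp only [twoCutoffLine_one] at hlow' hup'
  have hP₁ : ∀ v, c₁ * min 2 a * (v ⬝ᵥ v) ≤ v ⬝ᵥ (H.toBlocks₁₁ - H.toBlocks₁₂ * (H.toBlocks₂₂)⁻¹ * H.toBlocks₂₁).mulVec v := by
    intro v
    have h1 := hlow' v
    have h2 := lower18_zero hn ha.le hRc v
    have : c₁ * (min 2 a * (v ⬝ᵥ v)) ≤ c₁ * (v ⬝ᵥ (runA n L a R').mulVec v) := mul_le_mul_of_nonneg_left h2 hc₁pos.le
    linarith
  have hup : ∀ v, v ⬝ᵥ (H.toBlocks₁₁ - H.toBlocks₁₂ * (H.toBlocks₂₂)⁻¹ * H.toBlocks₂₁).mulVec v -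
      v ⬝ᵥ (runA n L a R').mulVec v ≤ (L : ℝ) ^ 2 * (v ⬝ᵥ (runA n L a R').mulVec v) := by
    intro v; have := hup' v; have := hP₀nn v; linarith
  have hlo : ∀ v, v ⬝ᵥ (runA n L a R').mulVec v -
      v ⬝ᵥ (H.toBlocks₁₁ - H.toBlocks₁₂ * (H.toBlocks₂₂)⁻¹ * H.toBlocks₂₁).mulVec v ≤
      (L : ℝ) ^ 2 * (v ⬝ᵥ (runA n L a R').mulVec v) := by
    intro v
    have h1 := hlow' v; have h2 := hP₀nn v
    have h3 : 0 ≤ c₁ * (v ⬝ᵥ (runA n L a R').mulVec v) := mul_nonneg hc₁pos.le h2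
    nlinarith
  have main := lineOpR_inv_sub_inv_rel (runA n L a R') H.toBlocks₁₁ H.toBlocks₁₂ H.toBlocks₂₁ H.toBlocks₂₂
    (fineOpR_isSymm n a 0 _) (schurB_isSymm hR'L n a) (mul_pos hc₁pos hmin) hc₁pos hc₁le (by positivity : (0 : ℝ) < (L : ℝ) ^ 2)
    hP₀ hP₁ hlow' hup hlo hs0 hs1 ht0 ht1 g
  exact main

end Summit.QuantumFields.BalabanUV.T4Continuum.NE7K1LinSchurLineDerivU1
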